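import Summits.BirchSwinnertonDyer.BirchSwinnertonDyer.Theorems.ByReductionTypeAtTwoMultTransportTwistedLiftUnramified
import Summits.BirchSwinnertonDyer.Rank1Residual.Additive.UnramifiedAwayBadPlaces
import Literature.NumberTheory.EllipticCurves.ZpExtensionGaloisTwistSelmerStructureProofs
import Literature.NumberTheory.EllipticCurves.ZpExtensionGaloisTwistLocal
import Literature.NumberTheory.EllipticCurves.GreenbergVatsal2000.NonPrimitiveSelmerGroup
import Literature.NumberTheory.GaloisCohomology.KolyvaginSystems
import HarnessLib

/-!
# T-42 in the kernel, LXXVI — road (S-C′), brick B2 (i): the twisted Poitou–Tate lift with EXACT targets at the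
# omitted primes `S₀` (Selmer structure `𝓕₀ = 𝓕` made STRICT at `S₀`), read over `K_∞` as a class of the
# NON-PRIMITIVE Selmer group `Sel^{Σ₀}_{p^∞}(E/K_∞)` with prescribed local classes above `S₀`

Cell `bsd-2adic` (run/shared/lean/pub/bsd-2adic/), seat `bsd-2adic-t42` GEN 32 (pen RC-521 «(S-C′) FUNDED», memo
`t42/DESIGN-T42-ADDENDUM-35.md` §A35.7–§A35.8). HONEST FRAMING: research route; THEOREMS ONLY (no `def`, no named fact, no
instance, no `sorry`); nothing booked; no door or class file is touched; BSD is not proved by any of this. PARTITION: X5@2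
multiplicative GV-transport rows (K4ᵐ B1·O1; the PRINT binder F1 = `Matsuno2008.cor23_lemma24_nonPrimitive_invariants_two`)
× p = 2 — reduces-the-named-input-of; bears_on K4 items 19922 / 19923 (`--supports stmt-BirchSwinnertonDyer-19923`).

## What

SURJ₂ (GV Prop. (2.1) at `2` for the CLASSICAL non-primitive group, LXXI/LXXV) asks for classes of `Sel^{Σ₀}(E/ℚ_∞)` with
PRESCRIBED local classes at the places above `Σ₀ = S₀`. Files XX–XXVI (`LIFT₂`/`LIFT₃`) lift targets at `p` and `∞` only:
their Selmer structure `𝓕 = W.twistedKummerSelmerStructure` (`ZpExtensionGaloisTwistSelmerStructure`) is EVERYTHING at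
`S₀`, so `SelmerComplement` prescribes nothing there. This file re-aims the lift (memo A35.8 B2):

* §1 `𝓕₀ := 𝓕.strictAt S₀` — the tree's `SelmerStructure.strictAt` (`KolyvaginSystems`, Sakamoto Def. 3.3 / Rubin Def. 2.1.1):
  the ZERO condition at `v ∈ S₀`, `𝓕` elsewhere (kernel of `twistedTorsionToLocalH1` at `∞` and at `v ∣ p`, unramified at the
  other finite places); unfolding lemmas, `𝓕₀ ≤ 𝓕`, both unramified outside `S = ∞ ∪ S₀ ∪ {v ∣ p}`. No new definition.
* §2 **`exists_mem_selmerGroup_kummer_res_eq_of_orthogonal`** — Poitou–Tate (`LocalInvariants.SelmerComplement` for the pair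
  `𝓕₀ ≤ 𝓕`; kernel theorem for `ℚ`, PRINT-by-name predicate for general `K`): a family `(t_v)_{v ∈ S₀}`,
  `t_v ∈ H¹(K_v, E[p^J](χ_u))`, whose local Tate pairings with every dual class `y ∈ H¹_{𝓕₀^*}(K, E[p^J](χ_u)^D)` vanish
  at every `v ∈ S₀`, is `(res_v x)_{v ∈ S₀}` — EXACTLY — for some `x` of the level-`K` twisted Selmer group `H¹_𝓕(K, E[p^J](χ_u))`
  (the targets at `∞` and at `v ∣ p` are `0 ∈ 𝓕_v`; Greenberg p. 124 «the map `γ` … is surjective», Howard Thm. 2.1.11).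
* §3 **`twistedTorsionToH1_mem_nonPrimitiveSelmerInfty_of_mem_selmerGroup`** — for `κ` CYCLOTOMIC, a class
  `x ∈ H¹_𝓕(K, E[p^J](χ_u))` maps under `twistedTorsionToH1` INTO `Sel^{Σ₀}_{p^∞}(E/K_∞)` (`GreenbergVatsal2000.nonPrimitiveSelmerInfty`):
  Kummer at `v ∣ p` and at `∞` (the kernel conditions of `𝓕`, square `localResOver_twistedTorsionToH1`), Kummer at the finite
  `v ∉ S₀`, `v ∤ p` (unramified ⇒ Kummer over the cyclotomic tower: file XX + `Additive.unramKer_le_localKerOver_of_isCyclotomic`),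
  all `Γ_K`-conjugates (`conjH1_twistedTorsionToH1_mem`); and `localResOver_v (twistedTorsionToH1 x) = twistedTorsionToLocalH1 (res_v x)`.
* §4 **`exists_mem_nonPrimitiveSelmerInfty_localResOver_eq_of_orthogonal`** — §2 + §3: orthogonal targets at `S₀` are the
  local classes over `K_∞` of ONE class of `Sel^{Σ₀}(E/K_∞)` restricted from the twisted module over `K` (so an eigenclass of
  every `conj_σ`, `conjH1_twistedTorsionToH1_eq_pow_zsmul`).

The orthogonality itself (the dual side: `H¹(ι^D) y = 0` from the local condition at `2` on models with no rational `2`-torsion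
point on the line — memo A35.8 B2′) is the sibling file `…TwistedDescentLevelDualAtTwo`; the local targets at `v ∈ S₀` (B1) are
the tree's `WeierstrassCurve.exists_twistedTorsionToLocalH1_eq_of_zsmul_conjH1_eq` (`ZpExtensionGaloisTwistLocalDescentProofs`).

References: [GreenbergLNM1716] §4 pp. 107–108, 122–124; [GreenbergVatsal2000] §2 Prop. (2.1) (pp. 17–19); [Howard2004HeegnerKolyvagin]
Def. 2.1.10, Thm. 2.1.11; [MilneADT2006] I Thm. 4.10; [Sakamoto2024] Def. 3.3.
-/

set_option autoImplicit false
set_option linter.dupNamespace false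

noncomputable section

open scoped Classical ContRepresentation

namespace Summit.BirchSwinnertonDyer.BirchSwinnertonDyer.Theorems.MultTransportTwistedDescent

open NumberField IsDedekindDomain Field WeierstrassCurve CategoryTheory
  Literature.NumberTheory.EllipticCurves Literature.NumberTheory.EllipticCurves.GreenbergVatsal2000
  Literature.NumberTheory.GaloisRepresentations Literature.NumberTheory.GaloisCohomology
open Literature.NumberTheory.GaloisRepresentations.DiscreteGaloisModule (localTatePairingZMod
  unramifiedSubgroup SelmerStructure)

-- `K : Type` (universe `0`): the `SignedTransportAtTwo`/`NonPrimitiveRestriction` consumers are stated for `K : Type`.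
variable {K : Type} [Field K] [NumberField K] (W : WeierstrassCurve K) (p : ℕ) [Fact p.Prime]
  (S₀ : Finset (HeightOneSpectrum (𝓞 K))) (κ : ZpExtension K p) (J : ℕ) (u : ℤ) (hu : (p : ℤ) ∣ u - 1)

/-! ## §1 The structure `𝓕₀ = 𝓕.strictAt S₀` (exact targets at `S₀`) -/

/-- `𝓕₀` at an infinite place: the kernel of `twistedTorsionToLocalH1` (the Kummer condition over `K_∞`, as `𝓕`).
[cite: GreenbergLNM1716, §4 p. 123] [cite: Sakamoto2024, Def. 3.3 (p. 922)] -/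
theorem strictKummer_inl (w : InfinitePlace K) :
    (W.twistedKummerSelmerStructure p S₀ κ J u hu).strictAt S₀ (Sum.inl w) =
      (W.twistedTorsionToLocalH1 p κ J u hu w.Completion).ker := by
  rw [SelmerStructure.strictAt, SelmerStructure.modify_inl, twistedKummerSelmerStructure_inl]

/-- `𝓕₀` at `v ∈ S₀`: the ZERO condition (targets are prescribed exactly there). [cite: Sakamoto2024, Def. 3.3 (p. 922)]
[cite: GreenbergVatsal2000, §2 Prop. (2.1)] -/
theorem strictKummer_inr_of_mem {v : HeightOneSpectrum (𝓞 K)} (hv : v ∈ S₀) :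
    (W.twistedKummerSelmerStructure p S₀ κ J u hu).strictAt S₀ (Sum.inr v) = ⊥ := by
  rw [SelmerStructure.strictAt, SelmerStructure.modify_inr_of_mem_strict _ _ (Finset.notMem_empty v) hv]

/-- `𝓕₀` agrees with `𝓕` at every finite `v ∉ S₀`. [cite: Sakamoto2024, Def. 3.3 (p. 922)] -/
theorem strictKummer_inr_of_not_mem {v : HeightOneSpectrum (𝓞 K)} (hv : v ∉ S₀) :
    (W.twistedKummerSelmerStructure p S₀ κ J u hu).strictAt S₀ (Sum.inr v) =
      W.twistedKummerSelmerStructure p S₀ κ J u hu (Sum.inr v) := by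
  rw [SelmerStructure.strictAt, SelmerStructure.modify_inr_of_not_mem _ _ (Finset.notMem_empty v) hv
    (Finset.notMem_empty v)]

/-- `𝓕₀` at `v ∋ p`, `v ∉ S₀`: the kernel of `twistedTorsionToLocalH1` (the Kummer condition over `K_∞` at the place above `v`).
[cite: GreenbergLNM1716, §4 p. 123] -/
theorem strictKummer_inr_of_mem_asIdeal {v : HeightOneSpectrum (𝓞 K)} (hv : v ∉ S₀)
    (hpv : ((p : ℕ) : 𝓞 K) ∈ v.asIdeal) :
    (W.twistedKummerSelmerStructure p S₀ κ J u hu).strictAt S₀ (Sum.inr v) =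
      (W.twistedTorsionToLocalH1 p κ J u hu (v.adicCompletion K)).ker := by
  rw [strictKummer_inr_of_not_mem W p S₀ κ J u hu hv,
    W.twistedKummerSelmerStructure_inr_of_mem_asIdeal p S₀ κ J u hu hv hpv]

/-- `𝓕₀` at a finite `v ∉ S₀` prime to `p`: unramified classes. [cite: GreenbergLNM1716, §4 p. 123] -/
theorem strictKummer_inr_of_not_mem_of_not_mem_asIdeal {v : HeightOneSpectrum (𝓞 K)} (hv : v ∉ S₀)
    (hpv : ((p : ℕ) : 𝓞 K) ∉ v.asIdeal) :
    (W.twistedKummerSelmerStructure p S₀ κ J u hu).strictAt S₀ (Sum.inr v) =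
      unramifiedSubgroup (GaloisRep.toLocal v (W.twistedTorsionGaloisModule p κ J u hu)) 1 := by
  rw [strictKummer_inr_of_not_mem W p S₀ κ J u hu hv,
    W.twistedKummerSelmerStructure_inr_of_not_mem p S₀ κ J u hu hv hpv]

/-- `𝓕₀ ≤ 𝓕` (they differ only at `S₀`, where `𝓕₀ = 0`). [cite: Howard2004HeegnerKolyvagin, Def. 2.1.10] -/
theorem strictKummer_le :
    (W.twistedKummerSelmerStructure p S₀ κ J u hu).strictAt S₀ ≤ W.twistedKummerSelmerStructure p S₀ κ J u hu := by
  intro v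
  rcases v with w | v
  · rw [SelmerStructure.strictAt, SelmerStructure.modify_inl]
  · by_cases hv : v ∈ S₀
    · rw [strictKummer_inr_of_mem W p S₀ κ J u hu hv]
      exact bot_le
    · rw [strictKummer_inr_of_not_mem W p S₀ κ J u hu hv]

/-- `𝓕₀` is a Selmer structure unramified outside `S = ∞ ∪ S₀ ∪ {v ∣ p}` (Howard Def. 2.1.10).
[cite: Howard2004HeegnerKolyvagin, Def. 2.1.10] -/
theorem isUnramifiedOutside_strictKummer :
    ((W.twistedKummerSelmerStructure p S₀ κ J u hu).strictAt S₀).IsUnramifiedOutside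
      (twistedDescentPlaces (K := K) p S₀) := by
  refine ⟨inl_mem_twistedDescentPlaces p S₀, fun v hv ↦ ?_⟩
  rw [not_mem_twistedDescentPlaces_iff] at hv
  exact strictKummer_inr_of_not_mem_of_not_mem_asIdeal W p S₀ κ J u hu hv.1 hv.2

/-- The dual structures of `𝓕₀` and `𝓕` AGREE off `S₀` (same local condition), place by place: at an infinite place …
[cite: Howard2004HeegnerKolyvagin, Def. 2.1.6] -/
theorem dualSelmerStructure_strictKummer_inl (inv : LocalInvariants K (p ^ J)) [Finite (W.geomTorsion ((p ^ J : ℕ) : ℤ))]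
    (w : InfinitePlace K) :
    inv.dualSelmerStructure (W.twistedTorsionGaloisModule p κ J u hu)
        ((W.twistedKummerSelmerStructure p S₀ κ J u hu).strictAt S₀) (Sum.inl w) =
      inv.dualSelmerStructure (W.twistedTorsionGaloisModule p κ J u hu)
        (W.twistedKummerSelmerStructure p S₀ κ J u hu) (Sum.inl w) := by
  rw [LocalInvariants.dualSelmerStructure_apply, LocalInvariants.dualSelmerStructure_apply, SelmerStructure.strictAt,
    SelmerStructure.modify_inl]

/-- … and at a finite `v ∉ S₀`. [cite: Howard2004HeegnerKolyvagin, Def. 2.1.6] -/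
theorem dualSelmerStructure_strictKummer_inr_of_not_mem (inv : LocalInvariants K (p ^ J))
    [Finite (W.geomTorsion ((p ^ J : ℕ) : ℤ))] {v : HeightOneSpectrum (𝓞 K)} (hv : v ∉ S₀) :
    inv.dualSelmerStructure (W.twistedTorsionGaloisModule p κ J u hu)
        ((W.twistedKummerSelmerStructure p S₀ κ J u hu).strictAt S₀) (Sum.inr v) =
      inv.dualSelmerStructure (W.twistedTorsionGaloisModule p κ J u hu)
        (W.twistedKummerSelmerStructure p S₀ κ J u hu) (Sum.inr v) := by
  rw [LocalInvariants.dualSelmerStructure_apply, LocalInvariants.dualSelmerStructure_apply,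
    strictKummer_inr_of_not_mem W p S₀ κ J u hu hv]

/-- At `v ∈ S₀` the dual condition of `𝓕₀` is EVERYTHING (`(0)^* = H¹(K_v, M^D)`): a dual class is unconstrained there —
the orthogonality at `S₀` must come from elsewhere (sibling `…LevelDualAtTwo`). [cite: Howard2004HeegnerKolyvagin, Def. 2.1.6] -/
theorem dualSelmerStructure_strictKummer_inr_of_mem (inv : LocalInvariants K (p ^ J))
    [Finite (W.geomTorsion ((p ^ J : ℕ) : ℤ))] {v : HeightOneSpectrum (𝓞 K)} (hv : v ∈ S₀) :
    inv.dualSelmerStructure (W.twistedTorsionGaloisModule p κ J u hu)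
        ((W.twistedKummerSelmerStructure p S₀ κ J u hu).strictAt S₀) (Sum.inr v) = ⊤ := by
  rw [LocalInvariants.dualSelmerStructure_apply, strictKummer_inr_of_mem W p S₀ κ J u hu hv,
    LocalInvariants.dualLocalCondition_bot]

/-! ## §2 The Poitou–Tate lift with exact targets at `S₀` -/

section Lift

variable [Finite (W.geomTorsion ((p ^ J : ℕ) : ℤ))]

/-- **Poitou–Tate lift with EXACT targets at `S₀`, inside the level-`K` twisted Selmer group `H¹_𝓕`.** Let `inv` have
`SelmerComplement`, `S₀ ∌ p`, and `E[p^J](χ_u)` be unramified with `p^J ∉ v` outside `S` (`hS`). If the targets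
`t_v ∈ H¹(K_v, E[p^J](χ_u))` (`v ∈ S₀`) pair to zero with every `y ∈ H¹_{𝓕₀^*}(K, E[p^J](χ_u)^D)` at every `v ∈ S₀`, then
`t_v = res_v x` for all `v ∈ S₀` for some `x ∈ H¹_𝓕(K, E[p^J](χ_u))` (Howard Thm. 2.1.11 for the pair `𝓕₀ ≤ 𝓕` with the
family `(t_v)_{S₀} ∪ (0)_{∞ ∪ {v∣p}}`; the summands at `∞` and `p` vanish because the target is `0`).
[cite: GreenbergLNM1716, §4 pp. 122–124] [cite: Howard2004HeegnerKolyvagin, Thm. 2.1.11 (arXiv:1202.6340 p. 6)] -/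
theorem exists_mem_selmerGroup_kummer_res_eq_of_orthogonal {inv : LocalInvariants K (p ^ J)}
    (hSC : inv.SelmerComplement)
    (hS : ∀ v : HeightOneSpectrum (𝓞 K), (Sum.inr v : Place K) ∉ twistedDescentPlaces (K := K) p S₀ →
      ((p ^ J : ℕ) : 𝓞 K) ∉ v.asIdeal ∧ GaloisRep.IsUnramifiedAt v (W.twistedTorsionGaloisModule p κ J u hu))
    (t : Π v : HeightOneSpectrum (𝓞 K),
      galoisCohomology ((W.twistedTorsionGaloisModule p κ J u hu).restrictField (v.adicCompletion K)) 1)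
    (horth : ∀ y ∈ (inv.dualSelmerStructure (W.twistedTorsionGaloisModule p κ J u hu)
        ((W.twistedKummerSelmerStructure p S₀ κ J u hu).strictAt S₀)).selmerGroup,
      ∀ v ∈ S₀,
        localTatePairingZMod (W.twistedTorsionGaloisModule p κ J u hu) (p ^ J) (Sum.inr v) (inv (Sum.inr v)) (t v)
          (galoisCohomology.localization ((W.twistedTorsionGaloisModule p κ J u hu).tateDual (p ^ J))
            (Sum.inr v) 1 y) = 0) :
    ∃ x ∈ (W.twistedKummerSelmerStructure p S₀ κ J u hu).selmerGroup,
      ∀ v ∈ S₀, galoisCohomology.res (W.twistedTorsionGaloisModule p κ J u hu) (v.adicCompletion K) 1 x = t v := by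
  have hM : ∀ m : geomTorsion W ((p ^ J : ℕ) : ℤ), (p ^ J) • m = 0 := W.pow_nsmul_geomTorsion_pow p J
  -- the `Place`-indexed target family: `t_v` at `v ∈ S₀`, `0` elsewhere
  let T : Π v : Place K, galoisCohomology ((W.twistedTorsionGaloisModule p κ J u hu).toLocal v) 1 := fun v ↦
    match v with
    | Sum.inl _ => 0
    | Sum.inr v => if v ∈ S₀ then t v else 0
  have hT_inl : ∀ w, T (Sum.inl w) = 0 := fun _ ↦ rfl
  have hT_inr : ∀ v, v ∈ S₀ → T (Sum.inr v) = t v := fun v hv ↦ by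
    change (if v ∈ S₀ then t v else 0) = t v
    rw [if_pos hv]
  have hT_inr0 : ∀ v, v ∉ S₀ → T (Sum.inr v) = 0 := fun v hv ↦ by
    change (if v ∈ S₀ then t v else 0) = 0
    rw [if_neg hv]
  -- `T_v ∈ 𝓕_v` on `S`
  have hTmem : ∀ v ∈ twistedDescentPlaces (K := K) p S₀, T v ∈ W.twistedKummerSelmerStructure p S₀ κ J u hu v := by
    intro v _
    rcases v with w | v
    · rw [hT_inl]; exact AddSubgroup.zero_mem _
    · by_cases hv : v ∈ S₀
      · rw [W.twistedKummerSelmerStructure_inr_of_mem p S₀ κ J u hu hv]; exact AddSubgroup.mem_top _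
      · rw [hT_inr0 v hv]; exact AddSubgroup.zero_mem _
  -- orthogonality of `T` to `H¹_{𝓕₀^*}`
  have horth' : ∀ y ∈ (inv.dualSelmerStructure (W.twistedTorsionGaloisModule p κ J u hu)
      ((W.twistedKummerSelmerStructure p S₀ κ J u hu).strictAt S₀)).selmerGroup,
      ∑ v ∈ twistedDescentPlaces (K := K) p S₀,
        localTatePairingZMod (W.twistedTorsionGaloisModule p κ J u hu) (p ^ J) v (inv v) (T v)
          (galoisCohomology.localization ((W.twistedTorsionGaloisModule p κ J u hu).tateDual (p ^ J)) v 1 y) = 0 := by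
    intro y hy
    refine Finset.sum_eq_zero fun v _ ↦ ?_
    rcases v with w | v
    · rw [hT_inl, map_zero, AddMonoidHom.zero_apply]
    · by_cases hv : v ∈ S₀
      · rw [hT_inr v hv]; exact horth y hy v hv
      · rw [hT_inr0 v hv, map_zero, AddMonoidHom.zero_apply]
  obtain ⟨x, hx, hxt⟩ := (hSC (W.twistedTorsionGaloisModule p κ J u hu) hM (twistedDescentPlaces (K := K) p S₀) hS
    ((W.twistedKummerSelmerStructure p S₀ κ J u hu).strictAt S₀) (W.twistedKummerSelmerStructure p S₀ κ J u hu)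
    (strictKummer_le W p S₀ κ J u hu) (isUnramifiedOutside_strictKummer W p S₀ κ J u hu)
    (W.isUnramifiedOutside_twistedKummerSelmerStructure p S₀ κ J u hu)).1 T hTmem horth'
  refine ⟨x, hx, fun v hv ↦ ?_⟩
  have h := hxt (Sum.inr v) ((inr_mem_twistedDescentPlaces_iff p S₀ v).2 (Or.inl hv))
  rw [strictKummer_inr_of_mem W p S₀ κ J u hu hv, AddSubgroup.mem_bot, sub_eq_zero, hT_inr v hv] at h
  exact h

end Lift

/-! ## §3 Reading `x ∈ H¹_𝓕(K, E[p^J](χ_u))` over `K_∞`: a class of `Sel^{Σ₀}_{p^∞}(E/K_∞)` -/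

/-- **A class of the level-`K` twisted Selmer group `H¹_𝓕(K, E[p^J](χ_u))` restricts into
`Sel^{Σ₀}_{p^∞}(E/K_∞)`** (`κ` CYCLOTOMIC; no hypothesis on `S₀`): Kummer at the places above `p` and at `∞` (the kernel conditions of `𝓕` and the
square `localResOver ∘ twistedTorsionToH1 = twistedTorsionToLocalH1 ∘ res`), Kummer at every finite `v ∉ S₀` prime to `p`
(unramified ⇒ Kummer over the cyclotomic tower, any reduction at `v`: file XX + `Additive.unramKer_le_localKerOver_of_isCyclotomic`),
and at every conjugate place (`conjH1_twistedTorsionToH1_mem`). Greenberg p. 124: «`H¹(F_Σ/F, M) → H¹(F_Σ/F_∞, M)^Γ` …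
`S_M(F_∞) = Sel ⊗ κ^s`». [cite: GreenbergLNM1716, §4 pp. 107, 124] [cite: GreenbergVatsal2000, §1 p. 7, §2 p. 17] -/
theorem twistedTorsionToH1_mem_nonPrimitiveSelmerInfty_of_mem_selmerGroup [W.IsElliptic] (hκ : κ.IsCyclotomic)
    {x : galoisCohomology (W.twistedTorsionGaloisModule p κ J u hu) 1}
    (hx : x ∈ (W.twistedKummerSelmerStructure p S₀ κ J u hu).selmerGroup) :
    W.twistedTorsionToH1 p κ J u hu x ∈ nonPrimitiveSelmerInfty W κ (↑S₀ : Set (HeightOneSpectrum (𝓞 K))) := by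
  set c := W.twistedTorsionToH1 p κ J u hu x with hc
  rw [SelmerStructure.mem_selmerGroup_iff] at hx
  -- Kummer at every finite `v ∉ S₀` (chosen place)
  have hfin : ∀ v : HeightOneSpectrum (𝓞 K), v ∉ S₀ → c ∈ W.localKerOver p κ.kerSubgroup (v.adicCompletion K) := by
    intro v hvS
    by_cases hpv : ((p : ℕ) : 𝓞 K) ∈ v.asIdeal
    · have h := hx (Sum.inr v)
      rw [W.twistedKummerSelmerStructure_inr_of_mem_asIdeal p S₀ κ J u hu hvS hpv] at h
      have h' : W.twistedTorsionToLocalH1 p κ J u hu (v.adicCompletion K)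
          (galoisCohomology.res (W.twistedTorsionGaloisModule p κ J u hu) (v.adicCompletion K) 1 x) = 0 := h
      rw [WeierstrassCurve.mem_localKerOver_iff, hc, W.localResOver_twistedTorsionToH1 p κ J u hu]
      exact h'
    · have h := hx (Sum.inr v)
      rw [W.twistedKummerSelmerStructure_inr_of_not_mem p S₀ κ J u hu hvS hpv] at h
      have hmem : c ∈ GreenbergVatsal2000.unramifiedKer κ.kerSubgroup (W.geomPrimaryTorsion p) v :=
        twistedTorsionToH1_mem_unramifiedKer W p κ J u hu v x h
      exact Summit.BirchSwinnertonDyer.Rank1Residual.Additive.unramKer_le_localKerOver_of_isCyclotomic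
        (κ := κ) (W := W) (p := p) (v := v) hκ hpv hmem
  -- Kummer at every infinite place (chosen place)
  have hinf : ∀ w : InfinitePlace K, c ∈ W.localKerOver p κ.kerSubgroup w.Completion := fun w ↦ by
    have h := hx (Sum.inl w)
    rw [twistedKummerSelmerStructure_inl] at h
    have h' : W.twistedTorsionToLocalH1 p κ J u hu w.Completion
        (galoisCohomology.res (W.twistedTorsionGaloisModule p κ J u hu) w.Completion 1 x) = 0 := h
    rw [WeierstrassCurve.mem_localKerOver_iff, hc, W.localResOver_twistedTorsionToH1 p κ J u hu]
    exact h'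
  rw [nonPrimitiveSelmerInfty_eq, mem_nonPrimitiveSelmerGroupOver_iff]
  exact ⟨fun v hv σ ↦ W.conjH1_twistedTorsionToH1_mem p κ J u hu _ x (hfin v (fun h ↦ hv (Finset.mem_coe.2 h))) σ,
    fun w σ ↦ W.conjH1_twistedTorsionToH1_mem p κ J u hu _ x (hinf w) σ⟩

/-- The local class over `K_∞` at the chosen place above `v` of `twistedTorsionToH1 x` is `twistedTorsionToLocalH1 (res_v x)`;
so `res_v x = t_v` prescribes it. [cite: GreenbergLNM1716, §4 p. 124] -/
theorem localResOver_twistedTorsionToH1_eq_of_res_eq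
    (x : galoisCohomology (W.twistedTorsionGaloisModule p κ J u hu) 1) (v : HeightOneSpectrum (𝓞 K))
    {t : galoisCohomology ((W.twistedTorsionGaloisModule p κ J u hu).restrictField (v.adicCompletion K)) 1}
    (h : galoisCohomology.res (W.twistedTorsionGaloisModule p κ J u hu) (v.adicCompletion K) 1 x = t) :
    W.localResOver p κ.kerSubgroup (v.adicCompletion K) (W.twistedTorsionToH1 p κ J u hu x) =
      W.twistedTorsionToLocalH1 p κ J u hu (v.adicCompletion K) t := by
  rw [W.localResOver_twistedTorsionToH1 p κ J u hu, h]

/-! ## §4 Assembly: orthogonal targets at `S₀` are realised by one class of `Sel^{Σ₀}(E/K_∞)` restricted from `K` -/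

/-- **Exact realisation at `S₀` of orthogonal targets by a class of `Sel^{Σ₀}_{p^∞}(E/K_∞)` coming from `K`.** `κ` cyclotomic,
`inv` with `SelmerComplement`, `E[p^J](χ_u)` unramified with `p^J ∉ v` outside `S`; if the targets `(t_v)_{v ∈ S₀}` pair to
zero at every `v ∈ S₀` with every dual class of `H¹_{𝓕₀^*}(K, E[p^J](χ_u)^D)`, then there is `x ∈ H¹(Γ_K, E[p^J](χ_u))` with
`twistedTorsionToH1 x ∈ Sel^{Σ₀}(E/K_∞)` and `localResOver_v (twistedTorsionToH1 x) = twistedTorsionToLocalH1 t_v` for every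
`v ∈ S₀` — GV's «`H¹(ℚ_Σ/ℚ_∞) → ∏_{ℓ∈Σ₀} 𝓗_ℓ(ℚ_∞)` hits the prescribed family» at finite level, for the twisted module.
[cite: GreenbergVatsal2000, §2 Prop. (2.1) (pp. 17–19)] [cite: GreenbergLNM1716, §4 pp. 122–124]
[cite: Howard2004HeegnerKolyvagin, Thm. 2.1.11 (arXiv:1202.6340 p. 6)] -/
theorem exists_mem_nonPrimitiveSelmerInfty_localResOver_eq_of_orthogonal [W.IsElliptic]
    [Finite (W.geomTorsion ((p ^ J : ℕ) : ℤ))]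
    (hκ : κ.IsCyclotomic) {inv : LocalInvariants K (p ^ J)} (hSC : inv.SelmerComplement)
    (hS : ∀ v : HeightOneSpectrum (𝓞 K), (Sum.inr v : Place K) ∉ twistedDescentPlaces (K := K) p S₀ →
      ((p ^ J : ℕ) : 𝓞 K) ∉ v.asIdeal ∧ GaloisRep.IsUnramifiedAt v (W.twistedTorsionGaloisModule p κ J u hu))
    (t : Π v : HeightOneSpectrum (𝓞 K),
      galoisCohomology ((W.twistedTorsionGaloisModule p κ J u hu).restrictField (v.adicCompletion K)) 1)
    (horth : ∀ y ∈ (inv.dualSelmerStructure (W.twistedTorsionGaloisModule p κ J u hu)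
        ((W.twistedKummerSelmerStructure p S₀ κ J u hu).strictAt S₀)).selmerGroup,
      ∀ v ∈ S₀,
        localTatePairingZMod (W.twistedTorsionGaloisModule p κ J u hu) (p ^ J) (Sum.inr v) (inv (Sum.inr v)) (t v)
          (galoisCohomology.localization ((W.twistedTorsionGaloisModule p κ J u hu).tateDual (p ^ J))
            (Sum.inr v) 1 y) = 0) :
    ∃ x : galoisCohomology (W.twistedTorsionGaloisModule p κ J u hu) 1,
      W.twistedTorsionToH1 p κ J u hu x ∈ nonPrimitiveSelmerInfty W κ (↑S₀ : Set (HeightOneSpectrum (𝓞 K))) ∧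
      ∀ v ∈ S₀, W.localResOver p κ.kerSubgroup (v.adicCompletion K) (W.twistedTorsionToH1 p κ J u hu x) =
        W.twistedTorsionToLocalH1 p κ J u hu (v.adicCompletion K) (t v) := by
  obtain ⟨x, hx, hxt⟩ := exists_mem_selmerGroup_kummer_res_eq_of_orthogonal W p S₀ κ J u hu hSC hS t horth
  exact ⟨x, twistedTorsionToH1_mem_nonPrimitiveSelmerInfty_of_mem_selmerGroup W p S₀ κ J u hu hκ hx,
    fun v hv ↦ localResOver_twistedTorsionToH1_eq_of_res_eq W p κ J u hu x v (hxt v hv)⟩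

end Summit.BirchSwinnertonDyer.BirchSwinnertonDyer.Theorems.MultTransportTwistedDescent

end
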